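import Summits.Ventures.HSemireg.WedgeHankelClassSpaceIrreducibleCharP
import Summits.Ventures.HSemireg.WedgeHankelSubstitutionQuarterTurn

/-!
# Venture HSemireg — THE SHARP IRREDUCIBILITY CRITERION FOR THE UNIMODULAR SUBSTITUTIONS ALONE: over a field with an element `t ≠ 0` whose SQUARE has `n + 1` distinct
# powers, th-7's class space is irreducible under the substitutions of DETERMINANT ONE (the `SL₂`-torus `SbC(t⁻¹ 0 0 t)`, the shear `SbC(1 1 0 1)`, the quarter turn
# `SbC(0 −1 1 0)` suffice) IFF every `C(n,j)` is a unit in `K` — the same criterion as for all substitutions (K3) and for the invertible ones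

HONEST FRAMING. Part of the Lean index of the computation cell `pub-hsemireg` (seat p10 gen 22, Sunday typer «UNIFORM-IN-n»).
Finite-dimensional EXTERIOR ALGEBRA + linear algebra ONLY: no variety, no cohomology theory, no sheaf, no Ext group, no semiregularity map;
nothing here says that HC / HC_CM / HC_AV holds; no Literature fact is declared or used.  Custodian versions as in `WedgeHankelSiegelIdeal` (1/3) and `WedgeHankelFrameChange`;
the dictionary (the class space = `Sym^n` of the letters' plane as an `SL₂(K)` / `GL₂(K)`-module) is QUOTED, never asserted.

WHAT IS IN THE TREE.  K3 (`WedgeHankelClassSpaceIrreducibleCharP`): `repr_smul_spikeBasis_mem_of_stable` / `exists_spikeBasis_mem_of_stable` (a subspace stable under the torus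
element `SbC(1 0 0 u)`, `u^0, …, u^n` distinct, contains every spike component of its vectors), `eq_top_of_torus_shear_swap_stable`, **`forall_stable_eq_top_iff_choose_ne_zero`**
(stable under ALL `SbC g`, singular ones included, iff all `C(n,j) ≠ 0`), `SbC_mem_comap_siegel` / `comap_siegel_ne_top` / `comap_siegel_eq_bot_iff` (the Siegel classes: a proper
subspace stable under everything, zero iff all `C(n,j) ≠ 0`), `exists_pow_injective_of_infinite`; J-leaf `eq_top_of_unipotent_stable` (the two shears suffice when `n! ≠ 0`); K10
`SbC_quarter_spike_top` (`Q E_n = E_0`); J5 `SbC_smul` (`SbC(tg) = t^n • SbC(g)`).  K3's criterion quantifies over singular and non-unimodular substitutions (its proof uses the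
torus `SbC(1 0 0 t)` of determinant `t` and the swap of determinant `−1`); Gen 21 CLOSE §OPEN (b) asked for the group versions.  THIS FILE (namespace
`Summit.Ventures.HSemireg.Wedge.HankelFrameChange` continued; imports K3, K10):
* §310 `SbC_stable_of_smul_stable` (stability under `SbC(tg)`, `t ≠ 0`, is stability under `SbC(g)`), `SbC_sl_torus_eq_smul` (`SbC(t⁻¹ 0 0 t) = t^{−n} • SbC(1 0 0 t²)`),
  `SbC_torus_sq_stable_of_sl_torus_stable`.
* §311 **`eq_top_of_sl_torus_shear_quarter_stable`**: all `C(n,j)` units, `(t²)^0, …, (t²)^n` pairwise distinct ⇒ every non-zero subspace stable under `SbC(t⁻¹ 0 0 t)`, `SbC(1 1 0 1)`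
  and `SbC(0 −1 1 0)` is `⊤` (K3's argument with the quarter turn in place of the swap); **`eq_top_of_forall_SL2_stable_of_choose_ne_zero`** (stable under every `SbC g` with
  `αδ − βγ = 1`), **`forall_SL2_stable_eq_top_iff_choose_ne_zero`: with such `t`, IRREDUCIBLE UNDER THE UNIMODULAR SUBSTITUTIONS ⇔ every `C(n,j) ≠ 0` in `K`**, and the
  invertible version **`forall_GL2_stable_eq_top_iff_choose_ne_zero`** (`t ≠ 0` with `t^0, …, t^n` distinct).
* §312 INFINITE FIELDS: `exists_sq_pow_injective_of_infinite` (some `t ≠ 0` with `(t²)^0, …, (t²)^n` distinct), **`forall_SL2_stable_eq_top_iff_choose_ne_zero_of_infinite`**,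
  `forall_GL2_stable_eq_top_iff_choose_ne_zero_of_infinite`, **`forall_SL2_stable_eq_top_iff_forall_stable_eq_top_of_infinite`** (over an infinite field: irreducible under `SL₂(K)`
  ⇔ irreducible under all substitutions), `eq_top_of_forall_SL2_stable_of_infinite_of_charZero`.
NOT typed here: finite fields with `|K| ∈ {n, n+1}` (K4 covers `|K| < n`); the unipotent subgroup alone in characteristic `p ≤ n`; anything Ext-side.  New names only.
-/

open Module

namespace Summit.Ventures.HSemireg.Wedge.HankelFrameChange

open Summit.Ventures.HSemireg.Wedge Summit.Ventures.HSemireg.Wedge.Kunneth Summit.Ventures.HSemireg.Wedge.Hankel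
  Summit.Ventures.HSemireg.Wedge.BasisFree Summit.Ventures.HSemireg.Wedge.HankelSiegel Summit.Ventures.HSemireg.Wedge.HankelSiegelIdeal
  Summit.Ventures.HSemireg.Wedge.KunnethKernel Summit.Ventures.HSemireg.Wedge.HankelRankOne Summit.Ventures.HSemireg.Wedge.KernelDuality

variable (K : Type*) [Field K] {n : ℕ}

/-! ## §310. Scalar multiples of a substitution have the same stable subspaces -/

/-- **a subspace stable under `SbC(tα, tβ, tγ, tδ)` (`t ≠ 0`) is stable under `SbC(α β γ δ)`** (`SbC(tg) = t^n • SbC(g)`, J5). -/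
theorem SbC_stable_of_smul_stable {t : K} (ht : t ≠ 0) {α β γ δ : K} {W : Submodule K (spikeSpan K n)}
    (hW : ∀ f ∈ W, SbC K (t * α) (t * β) (t * γ) (t * δ) f ∈ W) : ∀ f ∈ W, SbC K α β γ δ f ∈ W := fun f hf => by
  have h := Submodule.smul_mem W (t ^ n)⁻¹ (hW f hf)
  rwa [SbC_smul, LinearMap.smul_apply, smul_smul, inv_mul_cancel₀ (pow_ne_zero n ht), one_smul] at h

/-- conversely a subspace stable under `SbC(g)` is stable under every `SbC(tg)`. -/
theorem SbC_smul_stable_of_stable (t : K) {α β γ δ : K} {W : Submodule K (spikeSpan K n)} (hW : ∀ f ∈ W, SbC K α β γ δ f ∈ W) :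
    ∀ f ∈ W, SbC K (t * α) (t * β) (t * γ) (t * δ) f ∈ W := fun f hf => by
  rw [SbC_smul, LinearMap.smul_apply]; exact Submodule.smul_mem W _ (hW f hf)

/-- **the `SL₂`-torus is a scalar multiple of K3's torus: `SbC(1 0 0 t²) = t^n • SbC(t⁻¹ 0 0 t)`** (`t ≠ 0`). -/
theorem SbC_torus_sq_eq_smul_sl_torus {t : K} (ht : t ≠ 0) : SbC K 1 0 0 (t ^ 2) (n := n) = t ^ n • SbC K t⁻¹ 0 0 t := by
  rw [← SbC_smul, mul_inv_cancel₀ ht, mul_zero, sq]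

/-- hence **a subspace stable under the unimodular torus element `SbC(t⁻¹ 0 0 t)` is stable under `SbC(1 0 0 t²)`.** -/
theorem SbC_torus_sq_stable_of_sl_torus_stable {t : K} (ht : t ≠ 0) {W : Submodule K (spikeSpan K n)} (hW : ∀ f ∈ W, SbC K t⁻¹ 0 0 t f ∈ W) :
    ∀ f ∈ W, SbC K 1 0 0 (t ^ 2) f ∈ W := fun f hf => by
  rw [SbC_torus_sq_eq_smul_sl_torus K ht, LinearMap.smul_apply]; exact Submodule.smul_mem W _ (hW f hf)

/-! ## §311. The criterion for the unimodular and for the invertible substitutions -/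

/-- **THE UNIMODULAR GENERATORS SUFFICE: all `C(n,j)` units in `K`, `t ≠ 0` with `(t²)^0, …, (t²)^n` pairwise distinct ⇒ every non-zero subspace of th-7's class space stable
under `SbC(t⁻¹ 0 0 t)`, the shear `SbC(1 1 0 1)` and the quarter turn `SbC(0 −1 1 0)` is `⊤`** — K3's argument: some spike `E_q ∈ W` (torus `SbC(1 0 0 t²)`), the
`E_n`-component `C(n,q) E_n` of its shear lies in `W`, the quarter turn sends `E_n` to `E_0`, and every component `E_a` of the shear of `E_0` lies in `W`. -/
theorem eq_top_of_sl_torus_shear_quarter_stable (hbin : ∀ j ≤ n, ((n.choose j : ℕ) : K) ≠ 0) {t : K} (ht0 : t ≠ 0)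
    (ht : Function.Injective fun q : Fin (n + 1) => (t ^ 2) ^ (q : ℕ)) {W : Submodule K (spikeSpan K n)} (hD : ∀ f ∈ W, SbC K t⁻¹ 0 0 t f ∈ W)
    (hU : ∀ f ∈ W, SbC K 1 1 0 1 f ∈ W) (hQ : ∀ f ∈ W, SbC K 0 (-1) 1 0 f ∈ W) (hW : W ≠ ⊥) : W = ⊤ := by
  have hD' := SbC_torus_sq_stable_of_sl_torus_stable K ht0 hD
  obtain ⟨q, hq⟩ := exists_spikeBasis_mem_of_stable K ht hD' hW
  -- the point class: the `E_n`-component of `SbC(1 1 0 1) E_q` is `C(n,q) • E_n`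
  have hn : spikeBasis K n (Fin.last n) ∈ W := by
    have h := repr_smul_spikeBasis_mem_of_stable K ht hD' (hU _ hq) (Fin.last n)
    rw [repr_SbC_spikeBasis, sbMat_shear_apply, if_pos (by rw [Fin.val_last]; exact Nat.le_of_lt_succ q.2), one_pow, mul_one, Fin.val_last] at h
    have h' := Submodule.smul_mem W (((n.choose (q : ℕ) : ℕ) : K))⁻¹ h
    rwa [smul_smul, inv_mul_cancel₀ (hbin q (Nat.le_of_lt_succ q.2)), one_smul] at h'
  -- the pure class, by the quarter turn
  have h0 : spikeBasis K n 0 ∈ W := by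
    rw [spikeBasis_zero_eq, ← SbC_quarter_spike_top, ← spikeBasis_last_eq]
    exact hQ _ hn
  -- every spike: the `E_a`-component of `SbC(1 1 0 1) E_0` is `E_a`
  rw [eq_top_iff, ← (spikeBasis K n).span_eq, Submodule.span_le]
  rintro _ ⟨a, rfl⟩
  have h := repr_smul_spikeBasis_mem_of_stable K ht hD' (hU _ h0) a
  rw [repr_SbC_spikeBasis, sbMat_shear_apply, Fin.val_zero, if_pos (Nat.zero_le _), Nat.choose_zero_right, Nat.cast_one, one_pow, mul_one, one_smul] at h
  exact h

/-- **hence, under the same hypotheses, every non-zero subspace stable under all UNIMODULAR substitutions (`αδ − βγ = 1`) is `⊤`.** -/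
theorem eq_top_of_forall_SL2_stable_of_choose_ne_zero (hbin : ∀ j ≤ n, ((n.choose j : ℕ) : K) ≠ 0) {t : K} (ht0 : t ≠ 0)
    (ht : Function.Injective fun q : Fin (n + 1) => (t ^ 2) ^ (q : ℕ)) {W : Submodule K (spikeSpan K n)}
    (hall : ∀ α β γ δ : K, α * δ - β * γ = 1 → ∀ f ∈ W, SbC K α β γ δ f ∈ W) (hW : W ≠ ⊥) : W = ⊤ :=
  eq_top_of_sl_torus_shear_quarter_stable K hbin ht0 ht (hall t⁻¹ 0 0 t (by rw [inv_mul_cancel₀ ht0, zero_mul, sub_zero])) (hall 1 1 0 1 (by ring))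
    (hall 0 (-1) 1 0 (by ring)) hW

/-- **THE SHARP CRITERION FOR `SL₂`: over a field containing `t ≠ 0` with `(t²)^0, …, (t²)^n` pairwise distinct, th-7's class space is IRREDUCIBLE UNDER THE UNIMODULAR
SUBSTITUTIONS (every non-zero subspace stable under all `SbC g`, `det g = 1`, is `⊤`) IFF every `C(n,j)`, `j ≤ n`, is non-zero in `K`** («only if»: the Siegel classes). -/
theorem forall_SL2_stable_eq_top_iff_choose_ne_zero {t : K} (ht0 : t ≠ 0) (ht : Function.Injective fun q : Fin (n + 1) => (t ^ 2) ^ (q : ℕ)) :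
    (∀ W : Submodule K (spikeSpan K n), (∀ α β γ δ : K, α * δ - β * γ = 1 → ∀ f ∈ W, SbC K α β γ δ f ∈ W) → W ≠ ⊥ → W = ⊤) ↔
      ∀ j ≤ n, ((n.choose j : ℕ) : K) ≠ 0 := by
  constructor
  · intro h
    by_contra hbin
    exact comap_siegel_ne_top K (h _ (fun α β γ δ _ f hf => SbC_mem_comap_siegel K α β γ δ hf) (fun hb => hbin ((comap_siegel_eq_bot_iff K).mp hb)))
  · intro hbin W hall hW
    exact eq_top_of_forall_SL2_stable_of_choose_ne_zero K hbin ht0 ht hall hW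

/-- **THE INVERTIBLE SUBSTITUTIONS: `t ≠ 0` with `t^0, …, t^n` pairwise distinct, all `C(n,j)` units ⇒ every non-zero subspace stable under all `SbC g` with `αδ − βγ ≠ 0` is
`⊤`** (K3's torus / shear / swap are invertible). -/
theorem eq_top_of_forall_GL2_stable_of_choose_ne_zero (hbin : ∀ j ≤ n, ((n.choose j : ℕ) : K) ≠ 0) {t : K} (ht0 : t ≠ 0)
    (ht : Function.Injective fun q : Fin (n + 1) => t ^ (q : ℕ)) {W : Submodule K (spikeSpan K n)}
    (hall : ∀ α β γ δ : K, α * δ - β * γ ≠ 0 → ∀ f ∈ W, SbC K α β γ δ f ∈ W) (hW : W ≠ ⊥) : W = ⊤ :=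
  eq_top_of_torus_shear_swap_stable K hbin ht (hall 1 0 0 t (by rwa [one_mul, zero_mul, sub_zero])) (hall 1 1 0 1 (by norm_num)) (hall 0 1 1 0 (by norm_num)) hW

/-- **THE SHARP CRITERION FOR `GL₂`: with such `t`, irreducible under the INVERTIBLE substitutions iff every `C(n,j) ≠ 0` in `K`.** -/
theorem forall_GL2_stable_eq_top_iff_choose_ne_zero {t : K} (ht0 : t ≠ 0) (ht : Function.Injective fun q : Fin (n + 1) => t ^ (q : ℕ)) :
    (∀ W : Submodule K (spikeSpan K n), (∀ α β γ δ : K, α * δ - β * γ ≠ 0 → ∀ f ∈ W, SbC K α β γ δ f ∈ W) → W ≠ ⊥ → W = ⊤) ↔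
      ∀ j ≤ n, ((n.choose j : ℕ) : K) ≠ 0 := by
  constructor
  · intro h
    by_contra hbin
    exact comap_siegel_ne_top K (h _ (fun α β γ δ _ f hf => SbC_mem_comap_siegel K α β γ δ hf) (fun hb => hbin ((comap_siegel_eq_bot_iff K).mp hb)))
  · intro hbin W hall hW
    exact eq_top_of_forall_GL2_stable_of_choose_ne_zero K hbin ht0 ht hall hW

/-! ## §312. Infinite fields -/

omit [Field K] in
/-- **an infinite field contains `t ≠ 0` with `(t²)^0, …, (t²)^n` pairwise distinct** (K3 `exists_pow_injective_of_infinite` at `2n + 2`). -/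
theorem exists_sq_pow_injective_of_infinite (K : Type*) [Field K] [Infinite K] (n : ℕ) :
    ∃ t : K, t ≠ 0 ∧ Function.Injective fun q : Fin (n + 1) => (t ^ 2) ^ (q : ℕ) := by
  obtain ⟨t, ht⟩ := exists_pow_injective_of_infinite K (2 * n + 2)
  refine ⟨t, fun h0 => ?_, fun i j e => ?_⟩
  · have e : (fun q : Fin (2 * n + 2 + 1) => t ^ (q : ℕ)) ⟨1, by omega⟩ = (fun q : Fin (2 * n + 2 + 1) => t ^ (q : ℕ)) ⟨2, by omega⟩ := by
      simp only [h0, pow_one, zero_pow two_ne_zero]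
    exact absurd (congrArg Fin.val (ht e)) (by norm_num)
  · have e' : (fun q : Fin (2 * n + 2 + 1) => t ^ (q : ℕ)) ⟨2 * (i : ℕ), by omega⟩ = (fun q : Fin (2 * n + 2 + 1) => t ^ (q : ℕ)) ⟨2 * (j : ℕ), by omega⟩ := by
      have e2 : (t ^ 2) ^ (i : ℕ) = (t ^ 2) ^ (j : ℕ) := e
      rw [← pow_mul, ← pow_mul] at e2
      exact e2
    exact Fin.ext (by have h := congrArg Fin.val (ht e'); simp only at h; omega)

/-- **OVER EVERY INFINITE FIELD: th-7's class space is irreducible under the UNIMODULAR substitutions IFF every `C(n,j)` is non-zero in `K`.** -/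
theorem forall_SL2_stable_eq_top_iff_choose_ne_zero_of_infinite [Infinite K] :
    (∀ W : Submodule K (spikeSpan K n), (∀ α β γ δ : K, α * δ - β * γ = 1 → ∀ f ∈ W, SbC K α β γ δ f ∈ W) → W ≠ ⊥ → W = ⊤) ↔
      ∀ j ≤ n, ((n.choose j : ℕ) : K) ≠ 0 := by
  obtain ⟨t, ht0, ht⟩ := exists_sq_pow_injective_of_infinite K n
  exact forall_SL2_stable_eq_top_iff_choose_ne_zero K ht0 ht

/-- over every infinite field: irreducible under the INVERTIBLE substitutions iff every `C(n,j) ≠ 0` in `K`. -/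
theorem forall_GL2_stable_eq_top_iff_choose_ne_zero_of_infinite [Infinite K] :
    (∀ W : Submodule K (spikeSpan K n), (∀ α β γ δ : K, α * δ - β * γ ≠ 0 → ∀ f ∈ W, SbC K α β γ δ f ∈ W) → W ≠ ⊥ → W = ⊤) ↔
      ∀ j ≤ n, ((n.choose j : ℕ) : K) ≠ 0 := by
  constructor
  · intro h
    by_contra hbin
    exact comap_siegel_ne_top K (h _ (fun α β γ δ _ f hf => SbC_mem_comap_siegel K α β γ δ hf) (fun hb => hbin ((comap_siegel_eq_bot_iff K).mp hb)))
  · intro hbin W hall hW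
    exact (forall_SL2_stable_eq_top_iff_choose_ne_zero_of_infinite K).mpr hbin W (fun α β γ δ hd => hall α β γ δ (by rw [hd]; exact one_ne_zero)) hW

/-- **over an infinite field the three notions of irreducibility coincide: under `SL₂(K)`, under `GL₂(K)`, under all substitutions** (each ⇔ all `C(n,j) ≠ 0`; K3). -/
theorem forall_SL2_stable_eq_top_iff_forall_stable_eq_top_of_infinite [Infinite K] :
    (∀ W : Submodule K (spikeSpan K n), (∀ α β γ δ : K, α * δ - β * γ = 1 → ∀ f ∈ W, SbC K α β γ δ f ∈ W) → W ≠ ⊥ → W = ⊤) ↔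
      (∀ W : Submodule K (spikeSpan K n), (∀ α β γ δ : K, ∀ f ∈ W, SbC K α β γ δ f ∈ W) → W ≠ ⊥ → W = ⊤) := by
  rw [forall_SL2_stable_eq_top_iff_choose_ne_zero_of_infinite, forall_stable_eq_top_iff_choose_ne_zero_of_infinite]

/-- in characteristic `0` (infinite `K`): **every non-zero subspace stable under the unimodular substitutions is `⊤`** (the class space is an irreducible `SL₂(K)`-module). -/
theorem eq_top_of_forall_SL2_stable_of_infinite_of_charZero [Infinite K] [CharZero K] {W : Submodule K (spikeSpan K n)}
    (hall : ∀ α β γ δ : K, α * δ - β * γ = 1 → ∀ f ∈ W, SbC K α β γ δ f ∈ W) (hW : W ≠ ⊥) : W = ⊤ :=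
  (forall_SL2_stable_eq_top_iff_choose_ne_zero_of_infinite K).mpr (fun _ hj => Nat.cast_ne_zero.mpr (Nat.choose_pos hj).ne') W hall hW

end Summit.Ventures.HSemireg.Wedge.HankelFrameChange
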